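import Summits.QuantumFields.QCD.Theorems.RobustYangMillsRG.Negative.HaarPlaquetteDecorrelation
import Literature.MathematicalPhysics.QuantumLattice.GaugeGroups
import Literature.MathematicalPhysics.QuantumFieldTheory.StrongCouplingActivities
import HarnessLib

/-!
# Stub `stub_su3SignSet` of line `birth`
(crux `Summit.QuantumFields.QCD.Theses.NestedDissectionSea.RobustYangMillsRG`, item stmt-QuantumFields-17812,
route route-QuantumFields-NestedDissectionSea; shared verbatim with `HeavyThresholdYMBridge`)

## Summary

Haar-measure facts on `SU(3)` behind the sign observable of the line's negative certificate
`¬ FormatBallClustering` (a `±1/0`-valued link function `θ(u) = 1_S(u) - 1_S(g₀ u)`):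

* (a) the open set `S = {u | 3/2 < Re tr u}` is measurable, has positive Haar mass (it contains
  `1`, `Re tr 1 = 3`, and a Haar measure charges nonempty open sets), has mass at most `1/3`, and
  the centre element `g₀ = ζ = e^{2πi/3}·1` moves it off itself. The key inequality: for `u ∈ S`,
  `Re tr(ζu) = Re(ω tr u) = -Re tr u - Re(ω² tr u) < -3/2 + 3 = 3/2`, by `1 + ω + ω² = 0`,
  `|ω| = 1` and `|tr u| ≤ 3`. Hence `S`, `ζ⁻¹S = {u | ζu ∈ S}`, `ζ⁻²S = {u | ζ²u ∈ S}` are pairwise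
  disjoint (`ζ³ = 1`), of equal mass by left invariance (`MeasureTheory.measure_preimage_mul`),
  and of total mass `≤ 1`, so `3·Haar(S) ≤ 1`.
* (b) for `ε < 9/2` the open set `{g | ε < 3 - Re tr g}` contains `ζ` (`Re tr ζ = 3 Re ω = -3/2`,
  `Re ω = cos(2π/3) = -1/2`), hence is measurable of positive Haar mass.
* (c) `|Re tr u| ≤ 3` on `SU(3)`: `|Re tr u| ≤ |tr u| ≤ ∑ᵢ |uᵢᵢ| ≤ 3` (entries of a unitary matrix
  have modulus `≤ 1`, `entry_norm_bound_of_unitary`).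

All ingredients are Mathlib (`IsOpen.measure_pos`, `measure_preimage_mul`, `measure_union`,
`Complex.exp_ofReal_mul_I_re`, `Real.cos_pi_div_three`) and the tree (`haarProbability` and its
`IsHaarMeasure` / `IsProbabilityMeasure` instances, the centre element `ζ`, `trace_ζ_mul`,
`ω_pow_three`, `ω_ne_one` of `RobustYangMillsRG.Negative`; `‖ω‖ = 1` is inlined where used).
-/

noncomputable section

namespace Summit.QuantumFields.QCD.Cruxes.RobustYangMillsRG.Birth

open scoped BigOperators Topology Classical MeasureTheory Matrix ComplexConjugate ENNReal NNReal
open Filter Set Function TopologicalSpace MeasureTheory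
open Literature.MathematicalPhysics.QuantumLattice Literature.MathematicalPhysics.AQFT
  Literature.MathematicalPhysics.QuantumFieldTheory
open Summit.QuantumFields.QCD.Theorems.RobustYangMillsRG.Negative

/-! ### Trace bounds on `SU(3)` -/

/-- `|tr u| ≤ 3` for `u ∈ SU(3)`: each diagonal entry of a unitary matrix has modulus `≤ 1`.
[folklore] -/
theorem norm_trace_su3_le (u : SU3) : ‖(u : Matrix (Fin 3) (Fin 3) ℂ).trace‖ ≤ 3 := by
  have hu : (u : Matrix (Fin 3) (Fin 3) ℂ) ∈ Matrix.unitaryGroup (Fin 3) ℂ :=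
    Matrix.specialUnitaryGroup_le_unitaryGroup u.2
  calc ‖(u : Matrix (Fin 3) (Fin 3) ℂ).trace‖ = ‖∑ i, (u : Matrix (Fin 3) (Fin 3) ℂ) i i‖ := rfl
    _ ≤ ∑ i, ‖(u : Matrix (Fin 3) (Fin 3) ℂ) i i‖ := norm_sum_le _ _
    _ ≤ ∑ _i : Fin 3, (1 : ℝ) := Finset.sum_le_sum fun i _ => entry_norm_bound_of_unitary hu i i
    _ = 3 := by simp

/-- `|Re tr u| ≤ 3` for `u ∈ SU(3)`. [folklore] -/
theorem abs_re_trace_su3_le (u : SU3) : |(u : Matrix (Fin 3) (Fin 3) ℂ).trace.re| ≤ 3 :=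
  (Complex.abs_re_le_norm _).trans (norm_trace_su3_le u)

/-! ### The cube root of unity `ω` and the centre element `ζ` -/

/-- `ω² + ω + 1 = 0` (`ω³ = 1`, `ω ≠ 1`). [folklore] -/
theorem ω_sq_add_ω_add_one : ω ^ 2 + ω + 1 = 0 := by
  have h : (ω - 1) * (ω ^ 2 + ω + 1) = 0 := by linear_combination ω_pow_three
  rcases mul_eq_zero.1 h with h | h
  · exact absurd (sub_eq_zero.1 h) ω_ne_one
  · exact h

/-- `Re ω = cos(2π/3) = -1/2`. [folklore] -/
theorem ω_re : ω.re = -1 / 2 := by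
  have h1 : ω = Complex.exp (↑(2 * Real.pi / 3) * Complex.I) := by
    rw [ω]; congr 1; push_cast; ring
  rw [h1, Complex.exp_ofReal_mul_I_re]
  have h2 : (2 * Real.pi / 3 : ℝ) = Real.pi - Real.pi / 3 := by ring
  rw [h2, Real.cos_pi_sub, Real.cos_pi_div_three]
  norm_num

/-- `Re tr ζ = -3/2`. [folklore] -/
theorem re_trace_ζ : ((ζ : SU3) : Matrix (Fin 3) (Fin 3) ℂ).trace.re = -3 / 2 := by
  rw [coe_ζ, Matrix.trace_smul, Matrix.trace_one, Fintype.card_fin, smul_eq_mul]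
  simp [ω_re]
  norm_num

/-- `ζ³ = 1` in `SU(3)`. [folklore] -/
theorem ζ_pow_three : (ζ : SU3) ^ 3 = 1 := by
  apply Subtype.ext
  change ((ζ : SU3) : Matrix (Fin 3) (Fin 3) ℂ) ^ 3 = 1
  rw [coe_ζ, smul_pow, one_pow, ω_pow_three, one_smul]

/-- **Key inequality.** If `3/2 < Re tr u` then `Re tr(ζ u) < 3/2`:
`Re(ω z) = -Re z - Re(ω² z) ≤ -Re z + |z| < -3/2 + 3`. [folklore] -/
theorem re_trace_ζ_mul_lt (u : SU3) (hu : 3 / 2 < (u : Matrix (Fin 3) (Fin 3) ℂ).trace.re) :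
    ((ζ * u : SU3) : Matrix (Fin 3) (Fin 3) ℂ).trace.re < 3 / 2 := by
  rw [trace_ζ_mul]
  set z := (u : Matrix (Fin 3) (Fin 3) ℂ).trace
  have hz3 : ‖z‖ ≤ 3 := norm_trace_su3_le u
  have h1 : ω * z = -z - ω ^ 2 * z := by linear_combination z * ω_sq_add_ω_add_one
  -- `‖ω‖ = 1` (inlined: a root of unity has modulus one)
  have hω1 : ‖ω‖ = 1 := Complex.norm_eq_one_of_pow_eq_one ω_pow_three (by norm_num)
  have h2 : -3 ≤ (ω ^ 2 * z).re := by
    have h := (abs_le.1 (Complex.abs_re_le_norm (ω ^ 2 * z))).1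
    rw [norm_mul, norm_pow, hω1, one_pow, one_mul] at h
    linarith
  rw [h1, Complex.sub_re, Complex.neg_re]
  linarith

/-! ### The stub -/

/-- **Stub N2 — Haar facts on `SU(3)` behind the sign observable**: (a) a measurable set `S` of
positive Haar mass at most `1/3` and a group element `g₀` moving `S` off itself (witness:
`S = {Re tr u > 3/2}`, `g₀ = ζ = e^{2πi/3}·1`: for `u ∈ S`, `Re tr(ζu) = -Re tr u - Re(ω² tr u) < 3/2`
since `|tr u| ≤ 3`, so `S, ζ⁻¹S, ζ⁻²S` are disjoint left-translates, each of mass `q`, whence `3q ≤ 1`;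
`q > 0` because `S ∋ 1` is open and Haar charges open sets); (b) rough plaquettes have positive Haar
mass: for `ε < 9/2` the open set `{g | ε < 3 - Re tr g} ∋ ζ` has positive mass; (c) `|Re tr u| ≤ 3`
on `SU(3)`. [folklore] -/
theorem stub_su3SignSet :
    let G := ↥(Matrix.specialUnitaryGroup (Fin 3) ℂ)
    let ρ : G →* Matrix (Fin 3) (Fin 3) ℂ := fundamentalRep (Fin 3)
    (∃ (S : Set G) (g₀ : G), MeasurableSet S ∧ 0 < (haarProbability G).real S ∧
        (haarProbability G).real S ≤ 1 / 3 ∧ ∀ u ∈ S, g₀ * u ∉ S) ∧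
      (∀ ε : ℝ, ε < 9 / 2 → MeasurableSet {g : G | ε < 3 - (ρ g).trace.re} ∧
        0 < (haarProbability G).real {g : G | ε < 3 - (ρ g).trace.re}) ∧
      ∀ u : G, |(ρ u).trace.re| ≤ 3 := by
  intro G ρ
  -- the continuous function `u ↦ Re tr u` on `SU(3)`
  set f : SU3 → ℝ := fun u => ((u : Matrix (Fin 3) (Fin 3) ℂ).trace).re with hf
  have hfc : Continuous f :=
    Complex.continuous_re.comp (continuous_subtype_val.matrix_trace)
  set μ : Measure SU3 := haarProbability SU3
  refine ⟨?_, ?_, ?_⟩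
  · -- (a) the sign set `S = {3/2 < Re tr}` and `g₀ = ζ`
    set S : Set SU3 := {u | 3 / 2 < f u}
    have hSo : IsOpen S := isOpen_lt continuous_const hfc
    have hSm : MeasurableSet S := hSo.measurableSet
    have h1S : (1 : SU3) ∈ S := by
      change 3 / 2 < f 1
      simp only [hf, OneMemClass.coe_one, Matrix.trace_one, Fintype.card_fin]
      norm_num
    -- `ζ` moves `S` off itself
    have hmove : ∀ u ∈ S, ζ * u ∉ S := fun u hu h =>
      absurd (re_trace_ζ_mul_lt u hu) (not_lt.2 (le_of_lt h))
    -- the two further translates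
    set T₁ : Set SU3 := (fun u => ζ * u) ⁻¹' S
    set T₂ : Set SU3 := (fun u => ζ ^ 2 * u) ⁻¹' S
    have hT₁m : MeasurableSet T₁ := hSm.preimage (measurable_const_mul ζ)
    have hT₂m : MeasurableSet T₂ := hSm.preimage (measurable_const_mul (ζ ^ 2))
    have hμT₁ : μ T₁ = μ S := measure_preimage_mul μ ζ S
    have hμT₂ : μ T₂ = μ S := measure_preimage_mul μ (ζ ^ 2) S
    have hd₁ : Disjoint S T₁ := by
      rw [Set.disjoint_left]
      intro u hu hu'
      exact hmove u hu hu'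
    have hd₂ : Disjoint (S ∪ T₁) T₂ := by
      rw [Set.disjoint_left]
      rintro u (hu | hu) hu'
      · -- `u ∈ S`, `ζ² u ∈ S`: then `ζ³ u = u ∉ S`
        have h := hmove (ζ ^ 2 * u) hu'
        rw [← mul_assoc, ← pow_succ', ζ_pow_three, one_mul] at h
        exact h hu
      · -- `ζ u ∈ S`, `ζ² u ∈ S`
        have h := hmove (ζ * u) hu
        rw [← mul_assoc, ← pow_two] at h
        exact h hu'
    have hsum : μ S + μ S + μ S ≤ 1 := by
      calc μ S + μ S + μ S = μ S + μ T₁ + μ T₂ := by rw [hμT₁, hμT₂]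
        _ = μ (S ∪ T₁ ∪ T₂) := by rw [measure_union hd₂ hT₂m, measure_union hd₁ hT₁m]
        _ ≤ 1 := prob_le_one
    have hle : μ.real S ≤ 1 / 3 := by
      have h3 : (3 : ℝ≥0∞) * μ S ≤ 1 := by
        calc (3 : ℝ≥0∞) * μ S = μ S + μ S + μ S := by ring
          _ ≤ 1 := hsum
      have h4 : ((3 : ℝ≥0∞) * μ S).toReal ≤ (1 : ℝ≥0∞).toReal :=
        ENNReal.toReal_mono ENNReal.one_ne_top h3
      rw [ENNReal.toReal_mul, ENNReal.toReal_one] at h4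
      have h5 : μ.real S = (μ S).toReal := rfl
      rw [h5]
      norm_num at h4 ⊢
      linarith
    have hpos : 0 < μ.real S :=
      ENNReal.toReal_pos (hSo.measure_pos μ ⟨1, h1S⟩).ne' (measure_ne_top μ S)
    exact ⟨S, ζ, hSm, hpos, hle, hmove⟩
  · -- (b) rough plaquettes have positive Haar mass
    intro ε hε
    have hset : {g : SU3 | ε < 3 - (ρ g).trace.re} = {g | ε < 3 - f g} := rfl
    rw [hset]
    have ho : IsOpen {g : SU3 | ε < 3 - f g} :=
      isOpen_lt continuous_const (continuous_const.sub hfc)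
    have hζ : (ζ : SU3) ∈ {g : SU3 | ε < 3 - f g} := by
      change ε < 3 - f ζ
      simp only [hf, re_trace_ζ]
      linarith
    exact ⟨ho.measurableSet,
      ENNReal.toReal_pos (ho.measure_pos μ ⟨ζ, hζ⟩).ne' (measure_ne_top μ _)⟩
  · -- (c) `|Re tr u| ≤ 3`
    intro u
    exact abs_re_trace_su3_le u

end Summit.QuantumFields.QCD.Cruxes.RobustYangMillsRG.Birth
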